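import Summits.SmoothPoincare4.SmoothPoincare4.Theses.CongruenceShadows
import Literature.Topology.FourManifolds.SPC4HandlesProofs
import Literature.AlgebraicTopology.FundamentalGroup.InclHomTransport

/-!
# `AgkCor6Sufficiency` — negative-side support VII: the kernel condition of handlebody extension is necessary

Companion of `StablyTrivialTight.lean`, …, `LoadBearingRigidity.lean`, `WitnessNormalForm.lean`
(crux item `stmt-SmoothPoincare4-10894`, work file `Cruxes/AgkCor6Sufficiency/Disproof.lean`
§11.1, cycle 3).  The crux lines `level-set-kirby-triple` (stub `HandlebodyKernelExtension`) and
`lp-by-sphere-system-surgery` (stub `HandlebodyExtension`) assume: a diffeomorphism between the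
boundary surfaces of two genus-`g` handlebodies that carries `ker (π₁ ∂H → π₁ H)` onto
`ker (π₁ ∂H' → π₁ H')` extends over the handlebodies.  Recorded here, kernel-checked: the kernel
condition is NECESSARY — if `Φ : H ≅ H'` extends `φ : ∂H ≅ ∂H'` (`Φ ∘ incl = incl' ∘ φ`) then
`φ_*` maps the one kernel onto the other (`map_ker_eq_ker_of_extends`).  So those stubs are
`iff`s and cannot be weakened by dropping or relaxing the kernel hypothesis.  The content is pure
topology (`map_ker_eq_ker_of_semiconj`: a commuting square of continuous maps with homeomorphisms
as horizontal arrows), from functoriality of `π₁` (Hatcher, *Algebraic Topology* (2002), §1.1,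
p. 34) in the tree's vocabulary (`FundamentalGroup.mapOfEq_comp_apply`,
`Homeomorph.fundamentalGroupCongr`).  Nothing here concludes a Theses statement.

References: A. Hatcher, *Algebraic Topology* (2002), §1.1 p. 34 and Prop. 1.18; H. B. Griffiths,
*Automorphisms of a 3-dimensional handlebody*, Abh. Math. Sem. Univ. Hamburg 26 (1964) (the
sufficiency direction, not used here).
-/

noncomputable section

namespace Summit.SmoothPoincare4.SmoothPoincare4.Theorems.AgkCor6Sufficiency.Negative

open Literature.Topology.FourManifolds
open scoped Manifold ContDiff Topology ContinuousMap

section Topology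

variable {X X' Y Y' : Type*} [TopologicalSpace X] [TopologicalSpace X'] [TopologicalSpace Y]
  [TopologicalSpace Y']

/-- `FundamentalGroup.mapOfEq` along equal maps (with any two proofs of the base-point equation)
agree. [folklore] -/
theorem mapOfEq_congr_map {f g : C(X, Y)} (hfg : f = g) {x : X} {y : Y} (hf : f x = y)
    (hg : g x = y) (a : FundamentalGroup X x) :
    FundamentalGroup.mapOfEq f hf a = FundamentalGroup.mapOfEq g hg a := by
  subst hfg
  rfl

/-- **Kernels along a commuting square with homeomorphisms.**  For continuous `i : X → Y`,
`i' : X' → Y'` and homeomorphisms `φ : X ≃ₜ X'`, `Φ : Y ≃ₜ Y'` with `Φ ∘ i = i' ∘ φ`, the induced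
map `φ_*` carries `ker (i_* : π₁(X, x₀) → π₁(Y, i x₀))` ONTO `ker (i'_* : π₁(X', φ x₀) → π₁(Y', _))`
(Hatcher (2002), §1.1, p. 34: induced homomorphisms are functorial and homeomorphisms induce
isomorphisms). [cite: HatcherAT2002, §1.1 (p. 34) and Prop. 1.18] -/
theorem map_ker_eq_ker_of_semiconj (i : C(X, Y)) (i' : C(X', Y')) (φ : X ≃ₜ X') (Φ : Y ≃ₜ Y')
    (h : ∀ x, Φ (i x) = i' (φ x)) (x₀ : X) :
    ((FundamentalGroup.map i x₀).ker).map (FundamentalGroup.map (φ : C(X, X')) x₀) =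
      (FundamentalGroup.map i' (φ x₀)).ker := by
  have hcomp : i'.comp (φ : C(X, X')) = (Φ : C(Y, Y')).comp i :=
    ContinuousMap.ext fun x => (h x).symm
  have hx₀ : ((Φ : C(Y, Y')).comp i) x₀ = i' (φ x₀) := h x₀
  ext δ
  simp only [Subgroup.mem_map, MonoidHom.mem_ker, FundamentalGroup.map_eq_mapOfEq]
  constructor
  · rintro ⟨γ, hγ, rfl⟩
    rw [← FundamentalGroup.mapOfEq_comp_apply (φ : C(X, X')) i' rfl rfl γ,
      mapOfEq_congr_map hcomp _ hx₀,
      FundamentalGroup.mapOfEq_comp_apply i (Φ : C(Y, Y')) rfl (h x₀) γ, hγ, map_one]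
  · intro hδ
    refine ⟨FundamentalGroup.mapOfEq (φ.symm : C(X', X)) (φ.symm_apply_apply x₀) δ, ?_, ?_⟩
    · apply (Homeomorph.fundamentalGroupCongr Φ (h x₀)).injective
      rw [map_one, Homeomorph.fundamentalGroupCongr_apply,
        ← FundamentalGroup.mapOfEq_comp_apply i (Φ : C(Y, Y')) rfl (h x₀),
        mapOfEq_congr_map hcomp.symm _ (show (i'.comp (φ : C(X, X'))) x₀ = i' (φ x₀) from rfl),
        FundamentalGroup.mapOfEq_comp_apply (φ : C(X, X')) i' rfl rfl,
        ← FundamentalGroup.mapOfEq_comp_apply (φ.symm : C(X', X)) (φ : C(X, X'))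
          (φ.symm_apply_apply x₀) rfl δ,
        FundamentalGroup.mapOfEq_apply_eq_self_of_forall_eq
          ((φ : C(X, X')).comp (φ.symm : C(X', X))) (fun p => φ.apply_symm_apply p) δ]
      exact hδ
    · rw [← FundamentalGroup.mapOfEq_comp_apply (φ.symm : C(X', X)) (φ : C(X, X'))
          (φ.symm_apply_apply x₀) rfl δ]
      exact FundamentalGroup.mapOfEq_apply_eq_self_of_forall_eq
        ((φ : C(X, X')).comp (φ.symm : C(X', X))) (fun p => φ.apply_symm_apply p) δ

end Topology

/-- **The kernel condition of the handlebody-extension stubs is necessary** (shape of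
`HandlebodyKernelExtension` / `HandlebodyExtension`): if a diffeomorphism `Φ : H ≅ H'` of
`3`-manifolds with boundary extends the boundary diffeomorphism `φ` of their boundary data
(`Φ ∘ incl = incl' ∘ φ`), then `φ_*` maps `ker (π₁ ∂H → π₁ H)` onto `ker (π₁ ∂H' → π₁ H')`.
[cite: HatcherAT2002, §1.1 (p. 34) and Prop. 1.18] -/
theorem map_ker_eq_ker_of_extends {H H' : Type*} [TopologicalSpace H]
    [ChartedSpace (EuclideanHalfSpace 3) H] [TopologicalSpace H']
    [ChartedSpace (EuclideanHalfSpace 3) H']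
    (b : BoundaryData (𝓡∂ 3) H (𝓡 2)) (b' : BoundaryData (𝓡∂ 3) H' (𝓡 2))
    (φ : b.carrier ≃ₘ⟮𝓡 2, 𝓡 2⟯ b'.carrier) (Φ : H ≃ₘ⟮𝓡∂ 3, 𝓡∂ 3⟯ H')
    (hΦ : ⇑Φ ∘ b.incl = b'.incl ∘ ⇑φ) (x₀ : b.carrier) :
    ((FundamentalGroup.map (⟨b.incl, b.continuous_incl⟩ : C(b.carrier, H)) x₀).ker).map
        (FundamentalGroup.map (⟨φ, φ.continuous⟩ : C(b.carrier, b'.carrier)) x₀)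
      = (FundamentalGroup.map (⟨b'.incl, b'.continuous_incl⟩ : C(b'.carrier, H'))
          ((⟨φ, φ.continuous⟩ : C(b.carrier, b'.carrier)) x₀)).ker :=
  map_ker_eq_ker_of_semiconj ⟨b.incl, b.continuous_incl⟩ ⟨b'.incl, b'.continuous_incl⟩
    φ.toHomeomorph Φ.toHomeomorph (fun x => congrFun hΦ x) x₀

/-- **Extension ⇔ kernel condition, granted the sufficiency stub** (stated with the sufficiency
direction — the content of `HandlebodyKernelExtension` for the pair `(H, H')` — as hypothesis
`hSuff`): a boundary diffeomorphism extends over the handlebodies iff it carries kernel onto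
kernel. [cite: HatcherAT2002, §1.1 (p. 34) and Prop. 1.18] -/
theorem extends_iff_kernel {H H' : Type*} [TopologicalSpace H]
    [ChartedSpace (EuclideanHalfSpace 3) H] [TopologicalSpace H']
    [ChartedSpace (EuclideanHalfSpace 3) H']
    (b : BoundaryData (𝓡∂ 3) H (𝓡 2)) (b' : BoundaryData (𝓡∂ 3) H' (𝓡 2))
    (φ : b.carrier ≃ₘ⟮𝓡 2, 𝓡 2⟯ b'.carrier) (x₀ : b.carrier)
    (hSuff : ((FundamentalGroup.map (⟨b.incl, b.continuous_incl⟩ : C(b.carrier, H)) x₀).ker).map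
        (FundamentalGroup.map (⟨φ, φ.continuous⟩ : C(b.carrier, b'.carrier)) x₀)
      = (FundamentalGroup.map (⟨b'.incl, b'.continuous_incl⟩ : C(b'.carrier, H'))
          ((⟨φ, φ.continuous⟩ : C(b.carrier, b'.carrier)) x₀)).ker →
      ∃ Φ : H ≃ₘ⟮𝓡∂ 3, 𝓡∂ 3⟯ H', ⇑Φ ∘ b.incl = b'.incl ∘ ⇑φ) :
    (∃ Φ : H ≃ₘ⟮𝓡∂ 3, 𝓡∂ 3⟯ H', ⇑Φ ∘ b.incl = b'.incl ∘ ⇑φ) ↔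
      ((FundamentalGroup.map (⟨b.incl, b.continuous_incl⟩ : C(b.carrier, H)) x₀).ker).map
          (FundamentalGroup.map (⟨φ, φ.continuous⟩ : C(b.carrier, b'.carrier)) x₀)
        = (FundamentalGroup.map (⟨b'.incl, b'.continuous_incl⟩ : C(b'.carrier, H'))
            ((⟨φ, φ.continuous⟩ : C(b.carrier, b'.carrier)) x₀)).ker :=
  ⟨fun ⟨Φ, hΦ⟩ => map_ker_eq_ker_of_extends b b' φ Φ hΦ x₀, hSuff⟩

end Summit.SmoothPoincare4.SmoothPoincare4.Theorems.AgkCor6Sufficiency.Negative
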